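import Summits.BirchSwinnertonDyer.BirchSwinnertonDyer.Theorems.ByReductionTypeAtTwoKatoFreeSandwichAssembly
import Summits.BirchSwinnertonDyer.BirchSwinnertonDyer.Theses.ByReductionTypeAtTwo
import HarnessLib

/-!
# Route `ByReductionTypeAtTwo` (K4) — split glue `OrdMissingLowerBoundAtTwoOfChildren` (item stmt-BirchSwinnertonDyer-23765) CLOSED

Cell `bsd-2adic`, lead `cruxlead-stmt-BirchSwinnertonDyer-19577` (g4).  THEOREM ONLY — no definition, no named fact, no `sorry`;
BSD is not proved by any of this, and the parent crux 19577 `OrdMissingLowerBoundAtTwo` is NOT closed by this file (it stays open on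
its research child, the λ-half `OrdLambdaHalfAtTwo` = item stmt-BirchSwinnertonDyer-19556; the other child `OrdMLBPrintBundleAtTwo`,
item 23764, is a PRINT bundle by name).

`ordMissingLowerBoundAtTwoOfChildren_proof`: the split glue of crux 203 (route rev 25),
`OrdMissingLowerBoundAtTwoOfChildren := OrdMLBPrintBundleAtTwo → OrdLambdaHalfAtTwo → OrdMissingLowerBoundAtTwo`, holds BY NAME —
ONE application of the landed conditional kernel theorem of line `kato-free-lower-sandwich-two`,
`KatoFreeSandwich.ordMissingLowerBoundAtTwo_of_published_of_lambdaHalf` (p668589: PUB 19149 → Cassels → Abbes–Ullmo → the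
`X₁(N)`-optimal datum T2 → λ-half → crux), after unbundling the print child
`OrdMLBPrintBundleAtTwo = OrdPublishedInputsAtTwo ∧ bsdRHS_eq_of_isIsogenous ∧ abbesUllmo_not_dvd_maninConstant_of_not_dvd_level ∧
exists_optimal_gamma1ParametrizationData`.  The K4 decl `OrdLambdaHalfAtTwo` is item 19556's text verbatim, definitionally the constant
`Theorems.TwoAdicTwistConverse.OrdLambdaHalfAtTwo` consumed by p668589 (pen certificate
`plan/split-19573-19577/ClosingOrdMissingLowerBoundAtTwoOfChildren.lean`).  [cite: Kato2004Asterisque, Thm. 17.4] [cite: Stevens1989, §2]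
-/

set_option autoImplicit false
set_option linter.dupNamespace false

noncomputable section

namespace Summit.BirchSwinnertonDyer.BirchSwinnertonDyer.Theorems.KatoFreeSandwich

open Summit.BirchSwinnertonDyer.BirchSwinnertonDyer.Theses.ByReductionTypeAtTwo

/-- **Split glue `OrdMissingLowerBoundAtTwoOfChildren` (route `ByReductionTypeAtTwo`, item stmt-BirchSwinnertonDyer-23765) — proved
BY NAME**: the parent crux 19577 `OrdMissingLowerBoundAtTwo` from its two children, the print bundle `OrdMLBPrintBundleAtTwo`
(PUB 19149 ∧ Cassels ∧ Abbes–Ullmo ∧ T2, item 23764) and the λ-half `OrdLambdaHalfAtTwo` (item 19556), by the assembled line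
`KatoFreeSandwich.ordMissingLowerBoundAtTwo_of_published_of_lambdaHalf` (p668589).  Conditional glue: BSD is not proved, and
19577 / 19556 are not closed by this. [cite: Kato2004Asterisque, Thm. 17.4] [cite: Stevens1989, §2] -/
theorem ordMissingLowerBoundAtTwoOfChildren_proof : OrdMissingLowerBoundAtTwoOfChildren := by
  unfold OrdMissingLowerBoundAtTwoOfChildren
  rintro ⟨hPub, hCassels, hAU, hT2⟩ hLam
  exact ordMissingLowerBoundAtTwo_of_published_of_lambdaHalf hPub hCassels hAU hT2 hLam

end Summit.BirchSwinnertonDyer.BirchSwinnertonDyer.Theorems.KatoFreeSandwich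

end
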